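import Summits.ResolutionOfSingularities.ResolutionOfSingularities.Theses.FrobeniusClosing
import Summits.ResolutionOfSingularities.ResolutionOfSingularities.Theses.Descent
import Summits.ResolutionOfSingularities.ResolutionOfSingularities.Theorems.WeightedInvariantDescentPerfectToAllPicoverLink
import Summits.ResolutionOfSingularities.ResolutionOfSingularities.Theorems.RadicialJungCleanModelsSufficeReduction

/-!
# Crux `DescentPerfectToAll` (stmt-ResolutionOfSingularities-0549) — line `via-picover-jung` (crux-strategist b1, 2026-08-17)

The crux (shared by 21 routes; here concluded BY NAME for `FrobeniusClosing`, `WeightedInvariant` and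
`Descent`): for a prime `p`, resolution of every reduced separated finite-type scheme over every PERFECT
field of characteristic `p` implies `ResolutionInChar p` (all fields).

STATE (kernel-checked, landed): the crux is equivalent to its one-root residue F″
(`descentPerfectToAll_iff_oneRootStepCore`), all three earlier lines (root-of-a-constant ⊇
constant-foliation-descent, arc-special-fibre-transversality) died at a single stub equivalent to the crux
(skelvet 2026-08-17T04:52Z), and `Picover` (stmt-0554) implies the crux
(`Theorems.descentPerfectToAll_of_picover`, p113743, via the radicial bottom 0556 and the one-root
reduction). The 0554 crux-strategist (Cruxes/Picover/STRATEGY-CENSUS.md, 2026-08-17) found ONE switch with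
teeth for `Picover`: TRANSFER to Giraud's Jung condition for height-one radicial covers, whose return leg
(adapted clean model ⇒ log-regular Kummer-order atlas ⇒ Kato (10.4) ⇒ descent along `V^L → W^L` ⇒ degree-`p`
tower) is LANDED in this tree by route RadicialJung's crux chain and `Picover.OfDegP`.

THIS LINE composes the two landed edges, so that crux 0549 is attacked where an attack exists:

  `CleanModelsR ∧ Kato(10.4) ∧ Kato(4.1)`  ⟹  degree-`p` residue  ⟹  `Picover`  ⟹  `DescentPerfectToAll`.

Stubs (3; the composition `DescentPerfectToAll_of` takes their STATEMENTS as hypotheses and is sorry-free):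
* `stub_cleanModelsR` — THE RESEARCH STUB (open from `dim W = 4`; Giraud 1983 dim 2, Cossart 1987 dim 3 in
  completions): adapted log-clean regular models of the base exist for degree-`p` purely inseparable
  function-field extensions of a regular integral separated finite-type `W/k`, `k` ANY field of
  characteristic `p`. BY-NAME IDENTICAL to the research stub of `Cruxes/Picover/Lines/jung_clean_base.lean`
  and to the rider restatement `CleanModelsR` of route RadicialJung's crux `CleanModels` (stmt-15917) —
  DEDUPLICATE THERE: a lead on 0549 must not seat independent stub-workers on it.
* `stub_kato1994Resolution`, `stub_kato1994Normal` — NAMED FACTS (verbatim the Literature defs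
  `Kato1994_logRegularScheme_hasResolution`, `Kato1994_logRegularLocal_isIntegrallyClosed`; discharged when
  their `_holds` theorems land; no stub-worker).

Why it dodges the STUCK goals of the dead 0549 lines. F″ (`stub_oneRootStepCoreNormal`) and
`stub_robustLevelInseparable` are both crux-complete: every object imported from a perfect-field model must be
base-changed along an inseparable `k/k₀`, and only smoothness over the base survives that (STRATEGY-CENSUS-b1
§2.1, the import barrier); so the residual step is field-blind, and its honest local core is reduction of an
arithmetic rank-1 `p`-closed foliation / a height-one radicial cover in dimension `d ≥ 4` (c8 O1). The Jung
line IS field-blind (any `k`), never blows up the singular cover, and asks for an EMBEDDED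
log-principalization of the `K(W)^p`-class of one function on a REGULAR variety — strictly stronger than the
residue, hence falsifiable below the summit, with order / Hilbert–Samuel / `E`-permissibility of the coherent
differential-content ideal available as invariants (0554 census T4/S4). The imperfect ground field costs
nothing extra here: `stub_cleanModelsR` is already stated for every field `k` of characteristic `p`, and the
degree-`p` tower + radicial bottom + one-root reduction that carry it to 0549 are landed for every `k`.

Disproof.lean (Cruxes/DescentPerfectToAll v6.1) honoured: §1/§2 the antecedent is consumed exactly once, inside
the landed `descentPerfectToAll_of_picover` (perfect closure ⇒ finite p.i. level ⇒ radicial bottom), never by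
base-changing a regular scheme inseparably (§3–§5, `InseparableBaseChangeResolution`,
`RegularNotGeometricallyRegular`, `FrobeniusTwistResolution` are not touched: all blow-ups of this line live on a
regular `W` over the SAME field); §8/§10 landed negatives (`not_invariantsRegularOfNonsingularDerivation`,
`not_smoothModelAfterFGEnlargement`) concern the dead lines' stubs, none of which appears here. Negatives index
(`ledger negatives`, 2026-08-17): no refuted statement of this summit is an instance of any stub.
-/

noncomputable section

set_option linter.dupNamespace false

open CategoryTheory AlgebraicGeometry TopologicalSpace
open Literature.AlgebraicGeometry.Resolution Literature.AlgebraicGeometry.Motives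
open Summit.ResolutionOfSingularities.ResolutionOfSingularities.Theorems

namespace Summit.ResolutionOfSingularities.ResolutionOfSingularities.Cruxes.DescentPerfectToAll.ViaPicoverJung

/-! ## Stubs -/

/-- STUB (NAMED FACT, not research — verbatim the `Literature` named fact
`Literature.AlgebraicGeometry.Resolution.Kato1994_logRegularScheme_hasResolution`; no stub-worker).
**Kato 1994 (10.4)** (with (9.8), (9.11), (10.3); Nizioł 2006 Thm. 5.8): a quasi-compact scheme carrying a
log-regular atlas of fs Zariski charts has a resolution. [cite: Kato1994, (10.4)] [cite: Niziol2006, Thm. 5.8] -/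
theorem stub_kato1994Resolution : Kato1994_logRegularScheme_hasResolution.{0} := by
  sorry

/-- STUB (NAMED FACT, not research — verbatim the `Literature` named fact
`Literature.AlgebraicGeometry.Resolution.Kato1994_logRegularLocal_isIntegrallyClosed`; no stub-worker).
**Kato 1994 Thm. (4.1)**: a log-regular Noetherian local ring is a normal domain. [cite: Kato1994, Thm. (4.1)] -/
theorem stub_kato1994Normal : Kato1994_logRegularLocal_isIntegrallyClosed.{0} := by
  sorry

/-- STUB — THE RESEARCH CONTENT OF THE LINE (`CleanModelsR`, all primes; open from `dim W = 4`). BY-NAME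
IDENTICAL to `Cruxes/Picover/Lines/jung_clean_base.lean`'s `stub_cleanModelsR` = verbatim `∀ p, p.Prime →` the
hypothesis `hCMR` of `RadicialJung.CleanModelsSuffice.resolutionInChar_of_kato_of_adaptedModels` = the rider
form of route RadicialJung's crux `CleanModels` (stmt-15917). **Adapted log-clean regular models of the base
exist**: for `k` a field of characteristic `p`, `W` a regular integral separated `k`-scheme of finite type and
`L/K(W)` purely inseparable of degree `p`, there is a proper birational regular integral `π : V → W` with, at
every `v ∈ V`, a generator `y v ∈ L ∖ K(W)`, `(y v)^p = g v`, a regular system of parameters `t v` of `𝒪_{V,v}`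
whose first `r v` members are germs of sections on an open `U v ∋ v`, exponents prime to `p`, such that
`π^*(g v)` is a monomial in the first `m v` parameters (toroidal type) or a unit residually a non-`p`-th power
or differing from a `p`-th power by a parameter transversal to the boundary (regular type), with the joint and
overlap clauses making the pointwise Kato charts compatible. [cite: Giraud1983Jung]
[cite: CossartPiltant2009, Introduction p. 2] -/
theorem stub_cleanModelsR : ∀ (p : ℕ), p.Prime → ∀ (k : Type) [Field k] [CharP k p] (W : Scheme.{0}) [IsIntegral W] (f : W ⟶ Spec (.of k)) (L : Type) [Field L] [Algebra W.functionField L], IsSeparated f → LocallyOfFiniteType f → QuasiCompact f → Scheme.IsRegular W → IsPurelyInseparable W.functionField L → Module.finrank W.functionField L = p → ∃ (V : Scheme.{0}) (π : V ⟶ W) (_ : IsIntegral V) (_ : IsDominant π), IsProper π ∧ IsBirational π ∧ Scheme.IsRegular V ∧ ∃ (y : V → L) (g : V → W.functionField) (d r m : V → ℕ) (hrd : ∀ v, r v ≤ d v) (hmr : ∀ v, m v ≤ r v) (t : ∀ v : V, Fin (d v) → V.presheaf.stalk v) (a : ∀ v : V, Fin (m v) → ℕ) (U : V → V.Opens) (hU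 : ∀ v, v ∈ U v) (s : ∀ v : V, Fin (r v) → Γ(V, U v)), (∀ v : V, y v ∉ Set.range (algebraMap W.functionField L) ∧ algebraMap W.functionField L (g v) = y v ^ p ∧ Ideal.span (Set.range (t v)) = IsLocalRing.maximalIdeal (V.presheaf.stalk v) ∧ ringKrullDim (V.presheaf.stalk v) = (d v : WithBot ℕ∞) ∧ (∀ i : Fin (r v), V.presheaf.germ (U v) v (hU v) (s v i) = t v (Fin.castLE (hrd v) i)) ∧ (∀ i : Fin (m v), ¬ p ∣ a v i) ∧ ((0 < m v ∧ RatFn.functionFieldMap π (g v) = ∏ i : Fin (m v), (algebraMap (V.presheaf.stalk v) V.functionField (t v (Fin.castLE ((hmr v).trans (hrd v)) i))) ^ (a v i)) ∨ (m v = 0 ∧ ∃ u₀ : V.presheaf.stalk v, IsUnit u₀ ∧ RatFn.functionFieldMap π (g v) = algebraMap (V.presheaf.stalk v) V.functionField u₀ ∧ ((∀ x : V.presheaf.stalk v, u₀ - x ^ p ∉ IsLocalRing.maximalIdeal (V.presheaf.stalk v)) ∨ (∃ x : V.presheaf.stalk v, u₀ - x ^ p ∈ IsLocalRing.maximalIdeal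 (V.presheaf.stalk v) ∧ u₀ - x ^ p ∉ IsLocalRing.maximalIdeal (V.presheaf.stalk v) ^ 2 ⊔ Ideal.span (Set.range fun i : Fin (r v) => t v (Fin.castLE (hrd v) i))))))) ∧ (∀ (v w : V) (hw : w ∈ U v), ∃ (dw : ℕ) (tw : Fin dw → V.presheaf.stalk w) (ι : Fin (r v) → Fin dw), Ideal.span (Set.range tw) = IsLocalRing.maximalIdeal (V.presheaf.stalk w) ∧ ringKrullDim (V.presheaf.stalk w) = (dw : WithBot ℕ∞) ∧ (∀ i : Fin (r v), V.presheaf.germ (U v) w hw (s v i) ∈ IsLocalRing.maximalIdeal (V.presheaf.stalk w) → tw (ι i) = V.presheaf.germ (U v) w hw (s v i)) ∧ (∀ i j : Fin (r v), V.presheaf.germ (U v) w hw (s v i) ∈ IsLocalRing.maximalIdeal (V.presheaf.stalk w) → V.presheaf.germ (U v) w hw (s v j) ∈ IsLocalRing.maximalIdeal (V.presheaf.stalk w) → ι i = ι j → i = j)) ∧ (∀ (v v' w : V) (hw : w ∈ U v) (hw' : w ∈ U v'), ∃ μ : ℕ, ¬ p ∣ μ ∧ ∀ i : Fin (r v), V.presheaf.germ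 (U v) w hw (s v i) ∈ IsLocalRing.maximalIdeal (V.presheaf.stalk w) → ∃ i' : Fin (r v'), Associated (V.presheaf.germ (U v) w hw (s v i)) (V.presheaf.germ (U v') w hw' (s v' i')) ∧ ((i : ℕ) < m v ↔ (i' : ℕ) < m v') ∧ (∀ (hi : (i : ℕ) < m v) (hi' : (i' : ℕ) < m v'), a v' ⟨i', hi'⟩ ≡ μ * a v ⟨i, hi⟩ [MOD p])) := by
  sorry

/-! ## Composition (sorry-free; every edge below the stubs is a landed theorem) -/

/-- The degree-`p` residue of `Picover` from the three stub STATEMENTS: take the adapted clean model and apply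
`RadicialJung.CleanModelsSuffice.hasResolution_normalizationIn_of_adaptedModel` (charts + atlas + Kato
(10.4)/(4.1) + descent along `V^L → W^L`, landed p135821). [folklore] -/
theorem picoverDegP_of (hC : ∀ (p : ℕ), p.Prime → ∀ (k : Type) [Field k] [CharP k p] (W : Scheme.{0}) [IsIntegral W] (f : W ⟶ Spec (.of k)) (L : Type) [Field L] [Algebra W.functionField L], IsSeparated f → LocallyOfFiniteType f → QuasiCompact f → Scheme.IsRegular W → IsPurelyInseparable W.functionField L → Module.finrank W.functionField L = p → ∃ (V : Scheme.{0}) (π : V ⟶ W) (_ : IsIntegral V) (_ : IsDominant π), IsProper π ∧ IsBirational π ∧ Scheme.IsRegular V ∧ ∃ (y : V → L) (g : V → W.functionField) (d r m : V → ℕ) (hrd : ∀ v, r v ≤ d v) (hmr : ∀ v, m v ≤ r v) (t : ∀ v : V, Fin (d v) → V.presheaf.stalk v) (a : ∀ v : V, Fin (m v) → ℕ) (U : V → V.Opens) (hU : ∀ v, v ∈ U v) (s : ∀ v : V, Fin (r v) → Γ(V, U v)), (∀ v : V, y v ∉ Set.range (algebraMap W.functionField L) ∧ algebraMap W.functionField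 L (g v) = y v ^ p ∧ Ideal.span (Set.range (t v)) = IsLocalRing.maximalIdeal (V.presheaf.stalk v) ∧ ringKrullDim (V.presheaf.stalk v) = (d v : WithBot ℕ∞) ∧ (∀ i : Fin (r v), V.presheaf.germ (U v) v (hU v) (s v i) = t v (Fin.castLE (hrd v) i)) ∧ (∀ i : Fin (m v), ¬ p ∣ a v i) ∧ ((0 < m v ∧ RatFn.functionFieldMap π (g v) = ∏ i : Fin (m v), (algebraMap (V.presheaf.stalk v) V.functionField (t v (Fin.castLE ((hmr v).trans (hrd v)) i))) ^ (a v i)) ∨ (m v = 0 ∧ ∃ u₀ : V.presheaf.stalk v, IsUnit u₀ ∧ RatFn.functionFieldMap π (g v) = algebraMap (V.presheaf.stalk v) V.functionField u₀ ∧ ((∀ x : V.presheaf.stalk v, u₀ - x ^ p ∉ IsLocalRing.maximalIdeal (V.presheaf.stalk v)) ∨ (∃ x : V.presheaf.stalk v, u₀ - x ^ p ∈ IsLocalRing.maximalIdeal (V.presheaf.stalk v) ∧ u₀ - x ^ p ∉ IsLocalRing.maximalIdeal (V.presheaf.stalk v) ^ 2 ⊔ Ideal.span (Set.range fun i : Fin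 (r v) => t v (Fin.castLE (hrd v) i))))))) ∧ (∀ (v w : V) (hw : w ∈ U v), ∃ (dw : ℕ) (tw : Fin dw → V.presheaf.stalk w) (ι : Fin (r v) → Fin dw), Ideal.span (Set.range tw) = IsLocalRing.maximalIdeal (V.presheaf.stalk w) ∧ ringKrullDim (V.presheaf.stalk w) = (dw : WithBot ℕ∞) ∧ (∀ i : Fin (r v), V.presheaf.germ (U v) w hw (s v i) ∈ IsLocalRing.maximalIdeal (V.presheaf.stalk w) → tw (ι i) = V.presheaf.germ (U v) w hw (s v i)) ∧ (∀ i j : Fin (r v), V.presheaf.germ (U v) w hw (s v i) ∈ IsLocalRing.maximalIdeal (V.presheaf.stalk w) → V.presheaf.germ (U v) w hw (s v j) ∈ IsLocalRing.maximalIdeal (V.presheaf.stalk w) → ι i = ι j → i = j)) ∧ (∀ (v v' w : V) (hw : w ∈ U v) (hw' : w ∈ U v'), ∃ μ : ℕ, ¬ p ∣ μ ∧ ∀ i : Fin (r v), V.presheaf.germ (U v) w hw (s v i) ∈ IsLocalRing.maximalIdeal (V.presheaf.stalk w) → ∃ i' : Fin (r v'), Associated (V.presheaf.germ (U v) w hw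 (s v i)) (V.presheaf.germ (U v') w hw' (s v' i')) ∧ ((i : ℕ) < m v ↔ (i' : ℕ) < m v') ∧ (∀ (hi : (i : ℕ) < m v) (hi' : (i' : ℕ) < m v'), a v' ⟨i', hi'⟩ ≡ μ * a v ⟨i, hi⟩ [MOD p]))) (hK : Kato1994_logRegularScheme_hasResolution.{0}) (hK4 : Kato1994_logRegularLocal_isIntegrallyClosed.{0}) :
    ∀ (p : ℕ), p.Prime → ∀ (k : Type) [Field k] [CharP k p] (W : Scheme.{0}) [IsIntegral W] (f : W ⟶ Spec (.of k)) (L : Type) [Field L] [Algebra W.functionField L], IsSeparated f → LocallyOfFiniteType f → QuasiCompact f → Scheme.IsRegular W → IsPurelyInseparable W.functionField L → Module.finrank W.functionField L = p → Scheme.HasResolution (normalizationIn W L) := by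
  intro p hp k _ _ W _ f L _ _ hs hl hq hr hpi hd
  haveI := hs; haveI := hl; haveI := hq; haveI := hpi
  obtain ⟨V, π, hVi, hdom, hprop, hbir, hVreg, hRv⟩ := hC p hp k W f L hs hl hq hr hpi hd
  haveI := hVi; haveI := hdom; haveI := hprop
  exact RadicialJung.CleanModelsSuffice.hasResolution_normalizationIn_of_adaptedModel
    hK hK4 p hp k W f L hd V π hbir hVreg hRv

/-- `Picover` (stmt-0554) from the three stub statements, by Temkin's degree-`p` tower
(`Picover.OfDegP.picover_of_picoverDegP`, landed p91343). [folklore] -/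
theorem picover_of (hC : ∀ (p : ℕ), p.Prime → ∀ (k : Type) [Field k] [CharP k p] (W : Scheme.{0}) [IsIntegral W] (f : W ⟶ Spec (.of k)) (L : Type) [Field L] [Algebra W.functionField L], IsSeparated f → LocallyOfFiniteType f → QuasiCompact f → Scheme.IsRegular W → IsPurelyInseparable W.functionField L → Module.finrank W.functionField L = p → ∃ (V : Scheme.{0}) (π : V ⟶ W) (_ : IsIntegral V) (_ : IsDominant π), IsProper π ∧ IsBirational π ∧ Scheme.IsRegular V ∧ ∃ (y : V → L) (g : V → W.functionField) (d r m : V → ℕ) (hrd : ∀ v, r v ≤ d v) (hmr : ∀ v, m v ≤ r v) (t : ∀ v : V, Fin (d v) → V.presheaf.stalk v) (a : ∀ v : V, Fin (m v) → ℕ) (U : V → V.Opens) (hU : ∀ v, v ∈ U v) (s : ∀ v : V, Fin (r v) → Γ(V, U v)), (∀ v : V, y v ∉ Set.range (algebraMap W.functionField L) ∧ algebraMap W.functionField L (g v) = y v ^ p ∧ Ideal.span (Set.range (t v)) = IsLocalRing.maximalIdeal (V.presheaf.stalk v) ∧ ringKrullDim (V.presheaf.stalk v) = (d v : WithBot ℕ∞)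 ∧ (∀ i : Fin (r v), V.presheaf.germ (U v) v (hU v) (s v i) = t v (Fin.castLE (hrd v) i)) ∧ (∀ i : Fin (m v), ¬ p ∣ a v i) ∧ ((0 < m v ∧ RatFn.functionFieldMap π (g v) = ∏ i : Fin (m v), (algebraMap (V.presheaf.stalk v) V.functionField (t v (Fin.castLE ((hmr v).trans (hrd v)) i))) ^ (a v i)) ∨ (m v = 0 ∧ ∃ u₀ : V.presheaf.stalk v, IsUnit u₀ ∧ RatFn.functionFieldMap π (g v) = algebraMap (V.presheaf.stalk v) V.functionField u₀ ∧ ((∀ x : V.presheaf.stalk v, u₀ - x ^ p ∉ IsLocalRing.maximalIdeal (V.presheaf.stalk v)) ∨ (∃ x : V.presheaf.stalk v, u₀ - x ^ p ∈ IsLocalRing.maximalIdeal (V.presheaf.stalk v) ∧ u₀ - x ^ p ∉ IsLocalRing.maximalIdeal (V.presheaf.stalk v) ^ 2 ⊔ Ideal.span (Set.range fun i : Fin (r v) => t v (Fin.castLE (hrd v) i))))))) ∧ (∀ (v w : V) (hw : w ∈ U v), ∃ (dw : ℕ) (tw : Fin dw → V.presheaf.stalk w) (ι : Fin (r v) → Fin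 dw), Ideal.span (Set.range tw) = IsLocalRing.maximalIdeal (V.presheaf.stalk w) ∧ ringKrullDim (V.presheaf.stalk w) = (dw : WithBot ℕ∞) ∧ (∀ i : Fin (r v), V.presheaf.germ (U v) w hw (s v i) ∈ IsLocalRing.maximalIdeal (V.presheaf.stalk w) → tw (ι i) = V.presheaf.germ (U v) w hw (s v i)) ∧ (∀ i j : Fin (r v), V.presheaf.germ (U v) w hw (s v i) ∈ IsLocalRing.maximalIdeal (V.presheaf.stalk w) → V.presheaf.germ (U v) w hw (s v j) ∈ IsLocalRing.maximalIdeal (V.presheaf.stalk w) → ι i = ι j → i = j)) ∧ (∀ (v v' w : V) (hw : w ∈ U v) (hw' : w ∈ U v'), ∃ μ : ℕ, ¬ p ∣ μ ∧ ∀ i : Fin (r v), V.presheaf.germ (U v) w hw (s v i) ∈ IsLocalRing.maximalIdeal (V.presheaf.stalk w) → ∃ i' : Fin (r v'), Associated (V.presheaf.germ (U v) w hw (s v i)) (V.presheaf.germ (U v') w hw' (s v' i')) ∧ ((i : ℕ) < m v ↔ (i' : ℕ) < m v') ∧ (∀ (hi : (i : ℕ) < m v) (hi' : (i' : ℕ)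 < m v'), a v' ⟨i', hi'⟩ ≡ μ * a v ⟨i, hi⟩ [MOD p]))) (hK : Kato1994_logRegularScheme_hasResolution.{0}) (hK4 : Kato1994_logRegularLocal_isIntegrallyClosed.{0}) :
    Summit.ResolutionOfSingularities.ResolutionOfSingularities.Theses.PAlteration.Picover :=
  Picover.OfDegP.picover_of_picoverDegP (picoverDegP_of hC hK hK4)

/-- **The line closes the crux modulo its stubs — `FrobeniusClosing.DescentPerfectToAll` BY NAME**:
`Picover ⟹ DescentPerfectToAll` is `Theorems.descentPerfectToAll_of_picover` (landed p113743: radicial bottom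
0556 + one-root reduction + perfect closure); the route copies of the crux are definitionally equal. [folklore] -/
theorem DescentPerfectToAll_of (hC : ∀ (p : ℕ), p.Prime → ∀ (k : Type) [Field k] [CharP k p] (W : Scheme.{0}) [IsIntegral W] (f : W ⟶ Spec (.of k)) (L : Type) [Field L] [Algebra W.functionField L], IsSeparated f → LocallyOfFiniteType f → QuasiCompact f → Scheme.IsRegular W → IsPurelyInseparable W.functionField L → Module.finrank W.functionField L = p → ∃ (V : Scheme.{0}) (π : V ⟶ W) (_ : IsIntegral V) (_ : IsDominant π), IsProper π ∧ IsBirational π ∧ Scheme.IsRegular V ∧ ∃ (y : V → L) (g : V → W.functionField) (d r m : V → ℕ) (hrd : ∀ v, r v ≤ d v) (hmr : ∀ v, m v ≤ r v) (t : ∀ v : V, Fin (d v) → V.presheaf.stalk v) (a : ∀ v : V, Fin (m v) → ℕ) (U : V → V.Opens) (hU : ∀ v, v ∈ U v) (s : ∀ v : V, Fin (r v) → Γ(V, U v)), (∀ v : V, y v ∉ Set.range (algebraMap W.functionField L) ∧ algebraMap W.functionField L (g v) = y v ^ p ∧ Ideal.span (Set.range (t v)) = IsLocalRing.maximalIdeal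 (V.presheaf.stalk v) ∧ ringKrullDim (V.presheaf.stalk v) = (d v : WithBot ℕ∞) ∧ (∀ i : Fin (r v), V.presheaf.germ (U v) v (hU v) (s v i) = t v (Fin.castLE (hrd v) i)) ∧ (∀ i : Fin (m v), ¬ p ∣ a v i) ∧ ((0 < m v ∧ RatFn.functionFieldMap π (g v) = ∏ i : Fin (m v), (algebraMap (V.presheaf.stalk v) V.functionField (t v (Fin.castLE ((hmr v).trans (hrd v)) i))) ^ (a v i)) ∨ (m v = 0 ∧ ∃ u₀ : V.presheaf.stalk v, IsUnit u₀ ∧ RatFn.functionFieldMap π (g v) = algebraMap (V.presheaf.stalk v) V.functionField u₀ ∧ ((∀ x : V.presheaf.stalk v, u₀ - x ^ p ∉ IsLocalRing.maximalIdeal (V.presheaf.stalk v)) ∨ (∃ x : V.presheaf.stalk v, u₀ - x ^ p ∈ IsLocalRing.maximalIdeal (V.presheaf.stalk v) ∧ u₀ - x ^ p ∉ IsLocalRing.maximalIdeal (V.presheaf.stalk v) ^ 2 ⊔ Ideal.span (Set.range fun i : Fin (r v) => t v (Fin.castLE (hrd v) i))))))) ∧ (∀ (v w : V) (hw : w ∈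 U v), ∃ (dw : ℕ) (tw : Fin dw → V.presheaf.stalk w) (ι : Fin (r v) → Fin dw), Ideal.span (Set.range tw) = IsLocalRing.maximalIdeal (V.presheaf.stalk w) ∧ ringKrullDim (V.presheaf.stalk w) = (dw : WithBot ℕ∞) ∧ (∀ i : Fin (r v), V.presheaf.germ (U v) w hw (s v i) ∈ IsLocalRing.maximalIdeal (V.presheaf.stalk w) → tw (ι i) = V.presheaf.germ (U v) w hw (s v i)) ∧ (∀ i j : Fin (r v), V.presheaf.germ (U v) w hw (s v i) ∈ IsLocalRing.maximalIdeal (V.presheaf.stalk w) → V.presheaf.germ (U v) w hw (s v j) ∈ IsLocalRing.maximalIdeal (V.presheaf.stalk w) → ι i = ι j → i = j)) ∧ (∀ (v v' w : V) (hw : w ∈ U v) (hw' : w ∈ U v'), ∃ μ : ℕ, ¬ p ∣ μ ∧ ∀ i : Fin (r v), V.presheaf.germ (U v) w hw (s v i) ∈ IsLocalRing.maximalIdeal (V.presheaf.stalk w) → ∃ i' : Fin (r v'), Associated (V.presheaf.germ (U v) w hw (s v i)) (V.presheaf.germ (U v') w hw' (s v' i')) ∧ ((i : ℕ) < m v ↔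 (i' : ℕ) < m v') ∧ (∀ (hi : (i : ℕ) < m v) (hi' : (i' : ℕ) < m v'), a v' ⟨i', hi'⟩ ≡ μ * a v ⟨i, hi⟩ [MOD p]))) (hK : Kato1994_logRegularScheme_hasResolution.{0}) (hK4 : Kato1994_logRegularLocal_isIntegrallyClosed.{0}) :
    Summit.ResolutionOfSingularities.ResolutionOfSingularities.Theses.FrobeniusClosing.DescentPerfectToAll :=
  fun p hp H => descentPerfectToAll_of_picover (picover_of hC hK hK4) p hp H

/-- Same composition, concluding the `WeightedInvariant` copy of the crux by name. [folklore] -/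
theorem DescentPerfectToAll_of_weightedInvariant (hC : ∀ (p : ℕ), p.Prime → ∀ (k : Type) [Field k] [CharP k p] (W : Scheme.{0}) [IsIntegral W] (f : W ⟶ Spec (.of k)) (L : Type) [Field L] [Algebra W.functionField L], IsSeparated f → LocallyOfFiniteType f → QuasiCompact f → Scheme.IsRegular W → IsPurelyInseparable W.functionField L → Module.finrank W.functionField L = p → ∃ (V : Scheme.{0}) (π : V ⟶ W) (_ : IsIntegral V) (_ : IsDominant π), IsProper π ∧ IsBirational π ∧ Scheme.IsRegular V ∧ ∃ (y : V → L) (g : V → W.functionField) (d r m : V → ℕ) (hrd : ∀ v, r v ≤ d v) (hmr : ∀ v, m v ≤ r v) (t : ∀ v : V, Fin (d v) → V.presheaf.stalk v) (a : ∀ v : V, Fin (m v) → ℕ) (U : V → V.Opens) (hU : ∀ v, v ∈ U v) (s : ∀ v : V, Fin (r v) → Γ(V, U v)), (∀ v : V, y v ∉ Set.range (algebraMap W.functionField L) ∧ algebraMap W.functionField L (g v) = y v ^ p ∧ Ideal.span (Set.range (t v)) = IsLocalRing.maximalIdeal (V.presheaf.stalk v) ∧ ringKrullDim (V.presheaf.stalk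 v) = (d v : WithBot ℕ∞) ∧ (∀ i : Fin (r v), V.presheaf.germ (U v) v (hU v) (s v i) = t v (Fin.castLE (hrd v) i)) ∧ (∀ i : Fin (m v), ¬ p ∣ a v i) ∧ ((0 < m v ∧ RatFn.functionFieldMap π (g v) = ∏ i : Fin (m v), (algebraMap (V.presheaf.stalk v) V.functionField (t v (Fin.castLE ((hmr v).trans (hrd v)) i))) ^ (a v i)) ∨ (m v = 0 ∧ ∃ u₀ : V.presheaf.stalk v, IsUnit u₀ ∧ RatFn.functionFieldMap π (g v) = algebraMap (V.presheaf.stalk v) V.functionField u₀ ∧ ((∀ x : V.presheaf.stalk v, u₀ - x ^ p ∉ IsLocalRing.maximalIdeal (V.presheaf.stalk v)) ∨ (∃ x : V.presheaf.stalk v, u₀ - x ^ p ∈ IsLocalRing.maximalIdeal (V.presheaf.stalk v) ∧ u₀ - x ^ p ∉ IsLocalRing.maximalIdeal (V.presheaf.stalk v) ^ 2 ⊔ Ideal.span (Set.range fun i : Fin (r v) => t v (Fin.castLE (hrd v) i))))))) ∧ (∀ (v w : V) (hw : w ∈ U v), ∃ (dw : ℕ) (tw : Fin dw → V.presheaf.stalk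 w) (ι : Fin (r v) → Fin dw), Ideal.span (Set.range tw) = IsLocalRing.maximalIdeal (V.presheaf.stalk w) ∧ ringKrullDim (V.presheaf.stalk w) = (dw : WithBot ℕ∞) ∧ (∀ i : Fin (r v), V.presheaf.germ (U v) w hw (s v i) ∈ IsLocalRing.maximalIdeal (V.presheaf.stalk w) → tw (ι i) = V.presheaf.germ (U v) w hw (s v i)) ∧ (∀ i j : Fin (r v), V.presheaf.germ (U v) w hw (s v i) ∈ IsLocalRing.maximalIdeal (V.presheaf.stalk w) → V.presheaf.germ (U v) w hw (s v j) ∈ IsLocalRing.maximalIdeal (V.presheaf.stalk w) → ι i = ι j → i = j)) ∧ (∀ (v v' w : V) (hw : w ∈ U v) (hw' : w ∈ U v'), ∃ μ : ℕ, ¬ p ∣ μ ∧ ∀ i : Fin (r v), V.presheaf.germ (U v) w hw (s v i) ∈ IsLocalRing.maximalIdeal (V.presheaf.stalk w) → ∃ i' : Fin (r v'), Associated (V.presheaf.germ (U v) w hw (s v i)) (V.presheaf.germ (U v') w hw' (s v' i')) ∧ ((i : ℕ) < m v ↔ (i' : ℕ) < m v') ∧ (∀ (hi : (i : ℕ) <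 m v) (hi' : (i' : ℕ) < m v'), a v' ⟨i', hi'⟩ ≡ μ * a v ⟨i, hi⟩ [MOD p]))) (hK : Kato1994_logRegularScheme_hasResolution.{0}) (hK4 : Kato1994_logRegularLocal_isIntegrallyClosed.{0}) :
    Summit.ResolutionOfSingularities.ResolutionOfSingularities.Theses.WeightedInvariant.DescentPerfectToAll :=
  descentPerfectToAll_of_picover (picover_of hC hK hK4)

/-- Same composition, concluding the `Descent` copy of the crux (the item's original decl) by name. [folklore] -/
theorem DescentPerfectToAll_of_descent (hC : ∀ (p : ℕ), p.Prime → ∀ (k : Type) [Field k] [CharP k p] (W : Scheme.{0}) [IsIntegral W] (f : W ⟶ Spec (.of k)) (L : Type) [Field L] [Algebra W.functionField L], IsSeparated f → LocallyOfFiniteType f → QuasiCompact f → Scheme.IsRegular W → IsPurelyInseparable W.functionField L → Module.finrank W.functionField L = p → ∃ (V : Scheme.{0}) (π : V ⟶ W) (_ : IsIntegral V) (_ : IsDominant π), IsProper π ∧ IsBirational π ∧ Scheme.IsRegular V ∧ ∃ (y : V → L) (g : V → W.functionField) (d r m : V → ℕ) (hrd : ∀ v, r v ≤ d v) (hmr :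 ∀ v, m v ≤ r v) (t : ∀ v : V, Fin (d v) → V.presheaf.stalk v) (a : ∀ v : V, Fin (m v) → ℕ) (U : V → V.Opens) (hU : ∀ v, v ∈ U v) (s : ∀ v : V, Fin (r v) → Γ(V, U v)), (∀ v : V, y v ∉ Set.range (algebraMap W.functionField L) ∧ algebraMap W.functionField L (g v) = y v ^ p ∧ Ideal.span (Set.range (t v)) = IsLocalRing.maximalIdeal (V.presheaf.stalk v) ∧ ringKrullDim (V.presheaf.stalk v) = (d v : WithBot ℕ∞) ∧ (∀ i : Fin (r v), V.presheaf.germ (U v) v (hU v) (s v i) = t v (Fin.castLE (hrd v) i)) ∧ (∀ i : Fin (m v), ¬ p ∣ a v i) ∧ ((0 < m v ∧ RatFn.functionFieldMap π (g v) = ∏ i : Fin (m v), (algebraMap (V.presheaf.stalk v) V.functionField (t v (Fin.castLE ((hmr v).trans (hrd v)) i))) ^ (a v i)) ∨ (m v = 0 ∧ ∃ u₀ : V.presheaf.stalk v, IsUnit u₀ ∧ RatFn.functionFieldMap π (g v) = algebraMap (V.presheaf.stalk v) V.functionField u₀ ∧ ((∀ x : V.presheaf.stalk v, u₀ - x ^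 p ∉ IsLocalRing.maximalIdeal (V.presheaf.stalk v)) ∨ (∃ x : V.presheaf.stalk v, u₀ - x ^ p ∈ IsLocalRing.maximalIdeal (V.presheaf.stalk v) ∧ u₀ - x ^ p ∉ IsLocalRing.maximalIdeal (V.presheaf.stalk v) ^ 2 ⊔ Ideal.span (Set.range fun i : Fin (r v) => t v (Fin.castLE (hrd v) i))))))) ∧ (∀ (v w : V) (hw : w ∈ U v), ∃ (dw : ℕ) (tw : Fin dw → V.presheaf.stalk w) (ι : Fin (r v) → Fin dw), Ideal.span (Set.range tw) = IsLocalRing.maximalIdeal (V.presheaf.stalk w) ∧ ringKrullDim (V.presheaf.stalk w) = (dw : WithBot ℕ∞) ∧ (∀ i : Fin (r v), V.presheaf.germ (U v) w hw (s v i) ∈ IsLocalRing.maximalIdeal (V.presheaf.stalk w) → tw (ι i) = V.presheaf.germ (U v) w hw (s v i)) ∧ (∀ i j : Fin (r v), V.presheaf.germ (U v) w hw (s v i) ∈ IsLocalRing.maximalIdeal (V.presheaf.stalk w) → V.presheaf.germ (U v) w hw (s v j) ∈ IsLocalRing.maximalIdeal (V.presheaf.stalk w) → ι i = ι j → i = j))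 ∧ (∀ (v v' w : V) (hw : w ∈ U v) (hw' : w ∈ U v'), ∃ μ : ℕ, ¬ p ∣ μ ∧ ∀ i : Fin (r v), V.presheaf.germ (U v) w hw (s v i) ∈ IsLocalRing.maximalIdeal (V.presheaf.stalk w) → ∃ i' : Fin (r v'), Associated (V.presheaf.germ (U v) w hw (s v i)) (V.presheaf.germ (U v') w hw' (s v' i')) ∧ ((i : ℕ) < m v ↔ (i' : ℕ) < m v') ∧ (∀ (hi : (i : ℕ) < m v) (hi' : (i' : ℕ) < m v'), a v' ⟨i', hi'⟩ ≡ μ * a v ⟨i, hi⟩ [MOD p]))) (hK : Kato1994_logRegularScheme_hasResolution.{0}) (hK4 : Kato1994_logRegularLocal_isIntegrallyClosed.{0}) :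
    Summit.ResolutionOfSingularities.ResolutionOfSingularities.Theses.Descent.DescentPerfectToAll :=
  fun p hp H => descentPerfectToAll_of_picover (picover_of hC hK hK4) p hp H

/-- The crux from the (sorried) stubs themselves — bookkeeping form for the stub register. [folklore] -/
theorem DescentPerfectToAll_proof : Summit.ResolutionOfSingularities.ResolutionOfSingularities.Theses.FrobeniusClosing.DescentPerfectToAll :=
  DescentPerfectToAll_of stub_cleanModelsR stub_kato1994Resolution stub_kato1994Normal

end Summit.ResolutionOfSingularities.ResolutionOfSingularities.Cruxes.DescentPerfectToAll.ViaPicoverJung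

end
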